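/-
Copyright: statement-level skeleton of a published paper (lit-balaban cell, Phase-2 proof seat p26 gen 41). No claims beyond
what the kernel checks below.
-/
import Mathlib
import Literature.MathematicalPhysics.QuantumFieldTheory.Balaban1983to89.B3Eq322FromFeynmanRules
import Literature.MathematicalPhysics.QuantumFieldTheory.Balaban1983to89.B1Eq211ZeroFieldTorusLevels
import Literature.MathematicalPhysics.QuantumFieldTheory.Balaban1983to89.B3Sect3VectorSelfEnergy
import Literature.MathematicalPhysics.QuantumFieldTheory.Balaban1983to89.B3Eq322OneLegDifferentiated

/-!
# B3 — T. Bałaban, *(Higgs)₂,₃ quantum fields in a finite volume. III. Renormalization*, CMP **88** (1983) 411–445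
[Balaban1983Higgs3] — pp. 435–440: **THE TWO TORUS CARRIERS OF THE TREE BRIDGED for the evaluator lineage**: r15's (3.9) objects
(`B3Sect3ScalarSelfEnergy.{graphTerm39, counterTerm39, expr39}`), p18 g8's (3.21) objects (`B3Eq322OneLegDifferentiated.{expr321a, ker321,
expr321b}`) and r15's (3.26) left side (`B3Sect3VectorSelfEnergy.lhs326` with `kerA`, `kerB`, `pairSum`, `legFar`, `term3`, `term4`) live
on the `Setup` torus `Site Q j = Fin d → ZMod(2L^{m+K−j})`; the evaluator's values (FILEs 5–7: `expr39T`, `expr321aT`/`expr321bT`, `lhs326T`)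
live on the (Higgs)₂,₃ torus `HiggsLattice.Site P 0`.  FILEs 5–7 RESTATED the printed expressions symbol by symbol and declared the
restating in their HONEST SCOPE; this file DISCHARGES that caveat: along ANY site identification `e : HiggsLattice.Site P 0 ≃ Site
(setupAt S k) 0` commuting with the unit steps — in particular along the tree's own `B1Eq211ZeroFieldTorusLevels.eSiteAt` (§6) — the
ORIGINAL declarations evaluated on the transported data (`toS`, `toF`, `toK`, `toV`: fields, site functions, kernels, bond functions
read through `e⁻¹`) ARE the restated ones: `expr39 ∘ transport = expr39T`, `expr321a/b ∘ transport = expr321aT/bT`, `lhs326 ∘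
transport = lhs326T` (FILE 8 of the evaluator lineage)

statement-level skeleton of published theorems with citation tags; proofs where landed; nothing here is a claim about
the Yang–Mills mass gap

CITATION HEADER (lean-in-tree rule).  lit-balaban TYPED SKELETON (HOME `run/shared/lean/pub/lit-balaban/`), PHASE 2, seat p26 gen 41
(unit `lit-balaban-p26`; FILEs 5–7 `B3Eq39FromFeynmanRules` p365665, `B3Eq326FromFeynmanRules` p367199, `B3Eq322FromFeynmanRules` p368682);
free-target protocol G.5-34(d) (own lane).  ROWS **B3.Eq3.6-3.9**, **B3.Eq3.21-3.24**, **B3.Eq3.25-3.32** of `HOME/lit-balaban-r15/ROWS-B3.md`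
(fold owner r15; heads `proved` by r15 / p18 g8; this file is an OPTIONAL located member, zero head weight): it connects the located members
FILEs 5–7 to the head files' own declarations.  CONSUMES BY NAME, nothing re-declared: `B1Eq211ZeroFieldTorus.Shape`,
`B1Eq211ZeroFieldTorusLevels.{setupAt, eSiteAt, eSiteAt_symm_shift}` (the sub-family carrier identification `T^{(0)}_{ε} ≃ T^{(0)}` of the
level-`k` `Setup` torus); `Setup.{Params, Site, Site.shift, PBond, SiteField, VecField}`; `LatticeFieldCalculus.pdiff`;
`B3Sect3ScalarSelfEnergy.{Kernel, dKernel, coeff39, graphTerm39, counterTerm39, expr39, d1Kernel}`; `B3Sect3VectorSelfEnergy.{dAdjKernel,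
d2Kernel, kerA, kerB, pairSum, legFar, term3, term4, lhs326}`; `B3Eq322OneLegDifferentiated.{expr321a, ker321, expr321b}`; FILE 5's `dKernelT`,
`coeff39T`, `graphTerm39T`, `counterTerm39T`, `expr39T`; FILE 6's `dKernelL`, `dKernelR`, `d2KernelT`, `pairSumT`, `legFarT`, `kerAT`, `kerBT`,
`term3T`, `term4T`, `lhs326T`; FILE 7's `pdiffT`, `expr321aT`, `ker321T`, `expr321bT`; the typer's `HiggsLattice.{Params, Site, ScalarField,
VecField, PBond, ChargeData}`.

READING (declared).  (a) TRANSPORT: a datum of the (Higgs)₂,₃ carrier is read on the `Setup` carrier through `e⁻¹` (`toS e φ z = φ(e⁻¹z)`,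
`toK e G z z′ = G(e⁻¹z, e⁻¹z′)`, `toF e g = g ∘ e⁻¹`, `toV e A ⟨z, μ⟩ = A ⟨e⁻¹z, μ⟩` — the direction index is shared: `(setupAt S k).d = P.d`
definitionally); the only property of `e` used is `e⁻¹(z + e_μ) = e⁻¹(z) + e_μ` (hypothesis `he` of §§2–5; a theorem for `eSiteAt`, §6).
(b) The charge matrix enters r15's / p18's declarations as the linear map `↑C.q` of the typer's continuous `C.q`.  (c) LEVELS: the
evaluator's level-0 (`η = P.mesh 0`) expressions are matched with the head files' declarations at level `j = 0` of `setupAt S k` (any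
`k ≦ K`, any shape `S` of the sub-family of `B1Eq211ZeroFieldTorus`); the head files' declarations are level-polymorphic and carry `η`
as a free real parameter, so nothing is lost.  (d) DIRECTION of use: a consumer rewrites an evaluated graph value of FILEs 5–7 into the
head file's object by one `rw` (e.g. `rw [graphAmp_g36a_free, ← graphTerm39_bridge]`, `rw [class325_free_print, ← lhs326_bridge]`), after
which r15's / p18's theorems about `expr39`, `lhs326`, `expr321a/b` ((3.10)–(3.14), (3.27)–(3.32), (3.22)–(3.24)) apply to the value.

WHAT IS TYPED / PROVED (definitions with bodies + theorems; no `Prop` fact, no `sorry`; standard axioms).  §1 `toS`, `toF`, `toK`, `toV`;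
§2 `pdiff_toS` (`pdiff c μ (toS e φ) z = pdiffT c μ φ (e⁻¹z)`), `dKernel_toK`, `d1Kernel_toK` (= `dKernelL`), `dAdjKernel_toK` (= `dKernelR`),
`d2Kernel_toK`; §3 `coeff39_toK`, **`graphTerm39_bridge`**, **`counterTerm39_bridge`**, **`expr39_bridge`** (`expr39 η ↑C.q (toK Gj) (toK Gj′)
(toF g) (toF g′) (toS φ) (toS φ′) = expr39T η C.q Gj Gj′ g g′ φ φ′`); §4 **`expr321a_bridge`**, `ker321_bridge`, **`expr321b_bridge`**; §5
`kerA_bridge`, `kerB_bridge`, `legFar_bridge`, `pairSum_bridge`, `term3_bridge`, `term4_bridge`, **`lhs326_bridge`**; §6 along the tree's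
`eSiteAt S hk (0 ≤ k)`: `eSiteAt_symm_shift'`, **`expr39_eSiteAt`**, **`expr321_eSiteAt`**, **`lhs326_eSiteAt`**.
HONEST SCOPE.  (a) Pure bookkeeping: finite sums transported along a bijection of the index sets (`Fintype.sum_equiv`); nothing
analytic and nothing about print beyond FILEs 5–7 and the head files.  (b) The identification is available on the sub-family of tori of
`B1Eq211ZeroFieldTorus.Shape` (equal periods a power of `L`, `L` odd) — the family on which the tree's two carriers are bridged at all;
for a general `HiggsLattice.Params` no `Setup` torus with the same site set exists in the tree.  (c) Graph-level corollaries (the values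
of FILEs 5–7 rewritten into the head files' objects) are one `rw` away (reading (d)) and are not spelled out, to keep this file independent
of the graph vocabulary.  Unit `lit-balaban-p26` gen 41 (literature-prover-lit-balaban-p26-g41-0; filed by gen 42, literature-prover-lit-balaban-p26-g42-0),
HOME `run/shared/lean/pub/lit-balaban/`, 2026-08-23.
-/

open Finset
open scoped BigOperators InnerProductSpace

namespace Literature.MathematicalPhysics.QuantumFieldTheory.Balaban1983to89.B3EvaluatorCarrierBridge

open Literature.MathematicalPhysics.QuantumFieldTheory.Balaban1983to89.HiggsLattice (ChargeData)
open Literature.MathematicalPhysics.QuantumFieldTheory.Balaban1983to89.LatticeFieldCalculus (pdiff)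
open Literature.MathematicalPhysics.QuantumFieldTheory.Balaban1983to89.B1Eq211ZeroFieldTorus (Shape)
open Literature.MathematicalPhysics.QuantumFieldTheory.Balaban1983to89.B1Eq211ZeroFieldTorusLevels (setupAt eSiteAt eSiteAt_symm_shift)
open Literature.MathematicalPhysics.QuantumFieldTheory.Balaban1983to89.B3Sect3ScalarSelfEnergy (Kernel dKernel coeff39 graphTerm39 counterTerm39
  expr39 d1Kernel)
open Literature.MathematicalPhysics.QuantumFieldTheory.Balaban1983to89.B3Sect3VectorSelfEnergy (dAdjKernel d2Kernel kerA kerB pairSum legFar term3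
  term4 lhs326)
open Literature.MathematicalPhysics.QuantumFieldTheory.Balaban1983to89.B3Eq322OneLegDifferentiated (expr321a ker321 expr321b)
open Literature.MathematicalPhysics.QuantumFieldTheory.Balaban1983to89.B3Eq39FromFeynmanRules (dKernelT coeff39T graphTerm39T counterTerm39T
  expr39T)
open Literature.MathematicalPhysics.QuantumFieldTheory.Balaban1983to89.B3Eq326FromFeynmanRules (dKernelL dKernelR d2KernelT pairSumT legFarT kerAT
  kerBT term3T term4T lhs326T)
open Literature.MathematicalPhysics.QuantumFieldTheory.Balaban1983to89.B3Eq322FromFeynmanRules (pdiffT expr321aT ker321T expr321bT)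

noncomputable section

variable {P : HiggsLattice.Params} {N : ℕ} (S : Shape P) {k : ℕ}

/-! ## §1 Transport of the data along a site identification `e : T_η (HiggsLattice, level 0) ≃ T_η (Setup, level 0 of `setupAt S k`)` -/

/-- A scalar field of the (Higgs)₂,₃ carrier read on the `Setup` carrier: `φ^S(z) = φ(e⁻¹z)`. [cite: Balaban1982Higgs1, (1.2) p.604] -/
def toS (e : HiggsLattice.Site P 0 ≃ Site (setupAt S k) 0) (φ : HiggsLattice.ScalarField P 0 N) :
    SiteField (setupAt S k) 0 (HiggsCovariance.E N) :=
  fun z => φ (e.symm z)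

/-- A real site function read on the `Setup` carrier. [cite: Balaban1982Higgs1, (1.2) p.604] -/
def toF (e : HiggsLattice.Site P 0 ≃ Site (setupAt S k) 0) (g : HiggsLattice.Site P 0 → ℝ) : SiteField (setupAt S k) 0 ℝ :=
  fun z => g (e.symm z)

/-- A two-point kernel read on the `Setup` carrier. [cite: Balaban1982Higgs1, (1.2) p.604] -/
def toK (e : HiggsLattice.Site P 0 ≃ Site (setupAt S k) 0) (G : HiggsLattice.Site P 0 → HiggsLattice.Site P 0 → ℝ) : Kernel (setupAt S k) 0 :=
  fun z z' => G (e.symm z) (e.symm z')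

/-- A real vector field (bond function) read on the `Setup` carrier: `A^S(⟨z, μ⟩) = A(⟨e⁻¹z, μ⟩)`. [cite: Balaban1982Higgs1, (1.2) p.604] -/
def toV (e : HiggsLattice.Site P 0 ≃ Site (setupAt S k) 0) (A : HiggsLattice.VecField P 0) : VecField (setupAt S k) 0 ℝ :=
  fun b => A ⟨e.symm b.src, b.dir⟩

section Generic

variable (e : HiggsLattice.Site P 0 ≃ Site (setupAt S k) 0) (he : ∀ (z : Site (setupAt S k) 0) (μ : Fin P.d), e.symm (z.shift μ) = (e.symm z).shift μ)
include he

/-! ## §2 The difference quotients and kernels correspond -/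

/-- `LatticeFieldCalculus.pdiff` on the `Setup` carrier is FILE 7's `pdiffT`. [cite: Balaban1982Higgs1, (1.4) p.604] -/
theorem pdiff_toS (c : ℝ) (μ : Fin P.d) (φ : HiggsLattice.ScalarField P 0 N) (z : Site (setupAt S k) 0) :
    pdiff c μ (toS S e φ) z = pdiffT c μ φ (e.symm z) := by
  simp only [pdiff, toS, pdiffT, he]

/-- r15's `dKernel` (∂^η_μG∂^{η*}_μ) is FILE 5's `dKernelT`. [cite: Balaban1983Higgs3, (3.9) p.435] -/
theorem dKernel_toK (c : ℝ) (μ : Fin P.d) (G : HiggsLattice.Site P 0 → HiggsLattice.Site P 0 → ℝ) (z z' : Site (setupAt S k) 0) :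
    dKernel c μ (toK S e G) z z' = dKernelT c μ G (e.symm z) (e.symm z') := by
  simp only [dKernel, toK, dKernelT, he]

/-- r15's `d1Kernel` (∂^η_μG) is FILE 6's `dKernelL`. [cite: Balaban1983Higgs3, (3.23) p.439] -/
theorem d1Kernel_toK (c : ℝ) (μ : Fin P.d) (G : HiggsLattice.Site P 0 → HiggsLattice.Site P 0 → ℝ) (z z' : Site (setupAt S k) 0) :
    d1Kernel c μ (toK S e G) z z' = dKernelL c μ G (e.symm z) (e.symm z') := by
  simp only [d1Kernel, toK, dKernelL, he]

/-- r15's `dAdjKernel` (G∂^{η*}_μ) is FILE 6's `dKernelR`. [cite: Balaban1983Higgs3, (3.26) p.440] -/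
theorem dAdjKernel_toK (c : ℝ) (μ : Fin P.d) (G : HiggsLattice.Site P 0 → HiggsLattice.Site P 0 → ℝ) (y z : Site (setupAt S k) 0) :
    dAdjKernel c μ (toK S e G) y z = dKernelR c μ G (e.symm y) (e.symm z) := by
  simp only [dAdjKernel, toK, dKernelR, he]

/-- r15's `d2Kernel` (∂^η_μG∂^{η*}_{μ′}) is FILE 6's `d2KernelT`. [cite: Balaban1983Higgs3, (3.26) p.440] -/
theorem d2Kernel_toK (c : ℝ) (μ μ' : Fin P.d) (G : HiggsLattice.Site P 0 → HiggsLattice.Site P 0 → ℝ) (z z' : Site (setupAt S k) 0) :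
    d2Kernel c μ μ' (toK S e G) z z' = d2KernelT c μ μ' G (e.symm z) (e.symm z') := by
  simp only [d2Kernel, toK, d2KernelT, he]

/-! ## §3 (3.9): r15's `graphTerm39` / `counterTerm39` / `expr39` ARE FILE 5's `…T` on the transported data -/

/-- r15's `coeff39` is FILE 5's `coeff39T`. [cite: Balaban1983Higgs3, (3.9) p.435] -/
theorem coeff39_toK (η : ℝ) (Gj Gj' : HiggsLattice.Site P 0 → HiggsLattice.Site P 0 → ℝ) (g g' : HiggsLattice.Site P 0 → ℝ)
    (z z' : Site (setupAt S k) 0) :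
    coeff39 η (toK S e Gj) (toK S e Gj') (toF S e g) (toF S e g') z z' = coeff39T η Gj Gj' g g' (e.symm z) (e.symm z') := by
  simp only [coeff39, coeff39T, dKernel_toK S e he, toK, toF]
  rfl

/-- **r15's `graphTerm39` = FILE 5's `graphTerm39T`** (the first term of (3.9)) on the transported data, `q` the charge matrix.
[cite: Balaban1983Higgs3, (3.9) p.435] -/
theorem graphTerm39_bridge (η : ℝ) (C : ChargeData N) (Gj Gj' : HiggsLattice.Site P 0 → HiggsLattice.Site P 0 → ℝ)
    (g g' : HiggsLattice.Site P 0 → ℝ) (φ φ' : HiggsLattice.ScalarField P 0 N) :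
    graphTerm39 η (C.q : HiggsCovariance.E N →ₗ[ℝ] HiggsCovariance.E N) (toK S e Gj) (toK S e Gj') (toF S e g) (toF S e g') (toS S e φ) (toS S e φ') =
      graphTerm39T η C.q Gj Gj' g g' φ φ' := by
  unfold graphTerm39 graphTerm39T
  refine Fintype.sum_equiv e.symm _ _ fun z => Fintype.sum_equiv e.symm _ _ fun z' => ?_
  simp only [coeff39_toK S e he, toS, ContinuousLinearMap.coe_coe]
  rfl

/-- **r15's `counterTerm39` = FILE 5's `counterTerm39T`**. [cite: Balaban1983Higgs3, (3.9) p.435] -/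
theorem counterTerm39_bridge (η : ℝ) (C : ChargeData N) (Gj Gj' : HiggsLattice.Site P 0 → HiggsLattice.Site P 0 → ℝ)
    (g g' : HiggsLattice.Site P 0 → ℝ) (φ φ' : HiggsLattice.ScalarField P 0 N) :
    counterTerm39 η (C.q : HiggsCovariance.E N →ₗ[ℝ] HiggsCovariance.E N) (toK S e Gj) (toK S e Gj') (toF S e g) (toF S e g') (toS S e φ) (toS S e φ') =
      counterTerm39T η C.q Gj Gj' g g' φ φ' := by
  unfold counterTerm39 counterTerm39T
  refine Fintype.sum_equiv e.symm _ _ fun z => Fintype.sum_equiv e.symm _ _ fun z' => ?_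
  simp only [coeff39_toK S e he, toS, ContinuousLinearMap.coe_coe]
  rfl

/-- **r15's `expr39` ((3.9) as printed) = FILE 5's `expr39T`** on the transported data. [cite: Balaban1983Higgs3, (3.9) p.435] -/
theorem expr39_bridge (η : ℝ) (C : ChargeData N) (Gj Gj' : HiggsLattice.Site P 0 → HiggsLattice.Site P 0 → ℝ)
    (g g' : HiggsLattice.Site P 0 → ℝ) (φ φ' : HiggsLattice.ScalarField P 0 N) :
    expr39 η (C.q : HiggsCovariance.E N →ₗ[ℝ] HiggsCovariance.E N) (toK S e Gj) (toK S e Gj') (toF S e g) (toF S e g') (toS S e φ) (toS S e φ') =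
      expr39T η C.q Gj Gj' g g' φ φ' := by
  unfold expr39 expr39T
  rw [graphTerm39_bridge S e he, counterTerm39_bridge S e he]

/-! ## §4 (3.21): p18 g8's `expr321a` / `ker321` / `expr321b` ARE FILE 7's `…T` -/

/-- **p18's `expr321a` = FILE 7's `expr321aT`**. [cite: Balaban1983Higgs3, (3.21) p.438] -/
theorem expr321a_bridge (η : ℝ) (C : ChargeData N) (G : HiggsLattice.Site P 0 → HiggsLattice.Site P 0 → ℝ) (g : HiggsLattice.Site P 0 → ℝ)
    (φ φ' : HiggsLattice.ScalarField P 0 N) :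
    expr321a η (C.q : HiggsCovariance.E N →ₗ[ℝ] HiggsCovariance.E N) (toK S e G) (toF S e g) (toS S e φ) (toS S e φ') = expr321aT η C.q G g φ φ' := by
  unfold expr321a expr321aT
  refine Finset.sum_congr rfl fun μ _ => Fintype.sum_equiv e.symm _ _ fun z => ?_
  simp only [pdiff_toS S e he, toK, toF, toS, ContinuousLinearMap.coe_coe]
  rfl

/-- **p18's `ker321` = FILE 7's `ker321T`**. [cite: Balaban1983Higgs3, (3.21) p.438] -/
theorem ker321_bridge (η : ℝ) (μ : Fin P.d) (G0 Gj : HiggsLattice.Site P 0 → HiggsLattice.Site P 0 → ℝ) (g g' : HiggsLattice.Site P 0 → ℝ)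
    (z z' : Site (setupAt S k) 0) :
    ker321 η μ (toK S e G0) (toK S e Gj) (toF S e g) (toF S e g') z z' = ker321T η μ G0 Gj g g' (e.symm z) (e.symm z') := by
  simp only [ker321, ker321T, d1Kernel_toK S e he, toK, toF]

/-- **p18's `expr321b` = FILE 7's `expr321bT`**. [cite: Balaban1983Higgs3, (3.21) p.438] -/
theorem expr321b_bridge (η : ℝ) (C : ChargeData N) (G0 Gj : HiggsLattice.Site P 0 → HiggsLattice.Site P 0 → ℝ) (g g' : HiggsLattice.Site P 0 → ℝ)
    (φ φ' : HiggsLattice.ScalarField P 0 N) :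
    expr321b η (C.q : HiggsCovariance.E N →ₗ[ℝ] HiggsCovariance.E N) (toK S e G0) (toK S e Gj) (toF S e g) (toF S e g') (toS S e φ) (toS S e φ') =
      expr321bT η C.q G0 Gj g g' φ φ' := by
  unfold expr321b expr321bT
  refine Finset.sum_congr rfl fun μ _ => Fintype.sum_equiv e.symm _ _ fun z => Fintype.sum_equiv e.symm _ _ fun z' => ?_
  simp only [ker321_bridge S e he, pdiff_toS S e he, toS, ContinuousLinearMap.coe_coe]
  rfl

/-! ## §5 (3.26): r15's `lhs326` IS FILE 6's `lhs326T` -/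

/-- r15's `kerA` is FILE 6's `kerAT`. [cite: Balaban1983Higgs3, (3.26) p.440] -/
theorem kerA_bridge (η τ : ℝ) (Gj Gj' : HiggsLattice.Site P 0 → HiggsLattice.Site P 0 → ℝ) (μ μ' : Fin P.d) (z z' : Site (setupAt S k) 0) :
    kerA η τ (toK S e Gj) (toK S e Gj') μ μ' z z' = kerAT η τ Gj Gj' μ μ' (e.symm z) (e.symm z') := by
  simp only [kerA, kerAT, dAdjKernel_toK S e he]

/-- r15's `kerB` is FILE 6's `kerBT`. [cite: Balaban1983Higgs3, (3.26) p.440] -/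
theorem kerB_bridge (η τ : ℝ) (Gj Gj' : HiggsLattice.Site P 0 → HiggsLattice.Site P 0 → ℝ) (μ μ' : Fin P.d) (z z' : Site (setupAt S k) 0) :
    kerB η τ (toK S e Gj) (toK S e Gj') μ μ' z z' = kerBT η τ Gj Gj' μ μ' (e.symm z) (e.symm z') := by
  simp only [kerB, kerBT, d2Kernel_toK S e he, toK]

omit he in
/-- r15's `legFar` is FILE 6's `legFarT`. [cite: Balaban1983Higgs3, (3.26) p.440] -/
theorem legFar_bridge (g' : HiggsLattice.Site P 0 → ℝ) (A' : HiggsLattice.VecField P 0) (μ' : Fin P.d) (z z' : Site (setupAt S k) 0) :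
    legFar (toF S e g') (toV S e A') μ' z z' = legFarT g' A' μ' (e.symm z) (e.symm z') := rfl

omit he in
/-- r15's `pairSum` against a transported kernel family and leg is FILE 6's `pairSumT`. [cite: Balaban1983Higgs3, (3.26) p.440] -/
theorem pairSum_bridge (η : ℝ) (K : Fin P.d → Fin P.d → HiggsLattice.Site P 0 → HiggsLattice.Site P 0 → ℝ)
    (KS : Fin P.d → Fin P.d → Kernel (setupAt S k) 0) (hK : ∀ μ μ' z z', KS μ μ' z z' = K μ μ' (e.symm z) (e.symm z'))
    (g : HiggsLattice.Site P 0 → ℝ) (A : HiggsLattice.VecField P 0) (F : Fin P.d → HiggsLattice.Site P 0 → HiggsLattice.Site P 0 → ℝ)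
    (FS : Fin P.d → Site (setupAt S k) 0 → Site (setupAt S k) 0 → ℝ) (hF : ∀ μ' z z', FS μ' z z' = F μ' (e.symm z) (e.symm z')) :
    pairSum η KS (toF S e g) (toV S e A) FS = pairSumT η K g A F := by
  unfold pairSum pairSumT
  refine Fintype.sum_equiv e.symm _ _ fun z => Fintype.sum_equiv e.symm _ _ fun z' => ?_
  simp only [hK, hF, toF, toV]
  rfl

omit he in
/-- r15's `term3` is FILE 6's `term3T`. [cite: Balaban1983Higgs3, (3.26) p.440] -/
theorem term3_bridge (η τ : ℝ) (Gj'' : HiggsLattice.Site P 0 → HiggsLattice.Site P 0 → ℝ) (g g' : HiggsLattice.Site P 0 → ℝ) (A A' : HiggsLattice.VecField P 0) :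
    term3 η τ (toK S e Gj'') (toF S e g) (toF S e g') (toV S e A) (toV S e A') = term3T η τ Gj'' g g' A A' := by
  unfold term3 term3T
  refine Fintype.sum_equiv e.symm _ _ fun z => ?_
  simp only [toK, toF, toV]
  rfl

/-- r15's `term4` is FILE 6's `term4T`. [cite: Balaban1983Higgs3, (3.26) p.440] -/
theorem term4_bridge (η τ : ℝ) (Gj'' : HiggsLattice.Site P 0 → HiggsLattice.Site P 0 → ℝ) (g g' : HiggsLattice.Site P 0 → ℝ) (A A' : HiggsLattice.VecField P 0) :
    term4 η τ (toK S e Gj'') (toF S e g) (toF S e g') (toV S e A) (toV S e A') = term4T η τ Gj'' g g' A A' := by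
  unfold term4 term4T
  refine Fintype.sum_equiv e.symm _ _ fun z => ?_
  simp only [dAdjKernel_toK S e he, toF, toV]
  rfl

/-- **r15's `lhs326` (the printed left side of (3.26)) = FILE 6's `lhs326T`** on the transported data. [cite: Balaban1983Higgs3, (3.26) p.440] -/
theorem lhs326_bridge (η τ : ℝ) (Gj Gj' Gj'' : HiggsLattice.Site P 0 → HiggsLattice.Site P 0 → ℝ) (g g' : HiggsLattice.Site P 0 → ℝ)
    (A A' : HiggsLattice.VecField P 0) :
    lhs326 η τ (toK S e Gj) (toK S e Gj') (toK S e Gj'') (toF S e g) (toF S e g') (toV S e A) (toV S e A') = lhs326T η τ Gj Gj' Gj'' g g' A A' := by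
  unfold lhs326 lhs326T
  rw [pairSum_bridge S e η (kerAT η τ Gj Gj') _ (kerA_bridge S e he η τ Gj Gj') g A (legFarT g' A') _ (legFar_bridge S e g' A'),
    pairSum_bridge S e η (kerBT η τ Gj Gj') _ (kerB_bridge S e he η τ Gj Gj') g A (legFarT g' A') _ (legFar_bridge S e g' A'),
    term3_bridge S e, term4_bridge S e he]

end Generic

/-! ## §6 The identification of the tree: `eSiteAt` of `B1Eq211ZeroFieldTorusLevels` -/

section AtShape

variable (hk : k ≤ P.K)

/-- `eSiteAt` commutes with the unit steps (its inverse too) — the hypothesis of §§2–5. [cite: Balaban1982Higgs1, (1.2) p.604] -/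
theorem eSiteAt_symm_shift' (z : Site (setupAt S k) 0) (μ : Fin P.d) :
    (eSiteAt S hk (Nat.zero_le k)).symm (z.shift μ) = ((eSiteAt S hk (Nat.zero_le k)).symm z).shift μ :=
  eSiteAt_symm_shift S hk (Nat.zero_le k) z μ

/-- **(3.9) IDENTIFIED**: r15's `expr39` on the data transported along the tree's carrier identification `eSiteAt` IS FILE 5's `expr39T`.
[cite: Balaban1983Higgs3, (3.9) p.435] -/
theorem expr39_eSiteAt (η : ℝ) (C : ChargeData N) (Gj Gj' : HiggsLattice.Site P 0 → HiggsLattice.Site P 0 → ℝ)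
    (g g' : HiggsLattice.Site P 0 → ℝ) (φ φ' : HiggsLattice.ScalarField P 0 N) :
    expr39 η (C.q : HiggsCovariance.E N →ₗ[ℝ] HiggsCovariance.E N) (toK S (eSiteAt S hk (Nat.zero_le k)) Gj) (toK S (eSiteAt S hk (Nat.zero_le k)) Gj')
        (toF S (eSiteAt S hk (Nat.zero_le k)) g) (toF S (eSiteAt S hk (Nat.zero_le k)) g') (toS S (eSiteAt S hk (Nat.zero_le k)) φ)
        (toS S (eSiteAt S hk (Nat.zero_le k)) φ') =
      expr39T η C.q Gj Gj' g g' φ φ' :=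
  expr39_bridge S _ (eSiteAt_symm_shift' S hk) η C Gj Gj' g g' φ φ'

/-- **(3.21) IDENTIFIED**: p18's `expr321a`, `expr321b` along `eSiteAt` ARE FILE 7's `expr321aT`, `expr321bT`. [cite: Balaban1983Higgs3, (3.21) p.438] -/
theorem expr321_eSiteAt (η : ℝ) (C : ChargeData N) (G G0 Gj : HiggsLattice.Site P 0 → HiggsLattice.Site P 0 → ℝ) (g g' : HiggsLattice.Site P 0 → ℝ)
    (φ φ' : HiggsLattice.ScalarField P 0 N) :
    expr321a η (C.q : HiggsCovariance.E N →ₗ[ℝ] HiggsCovariance.E N) (toK S (eSiteAt S hk (Nat.zero_le k)) G) (toF S (eSiteAt S hk (Nat.zero_le k)) g)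
        (toS S (eSiteAt S hk (Nat.zero_le k)) φ) (toS S (eSiteAt S hk (Nat.zero_le k)) φ') = expr321aT η C.q G g φ φ' ∧
    expr321b η (C.q : HiggsCovariance.E N →ₗ[ℝ] HiggsCovariance.E N) (toK S (eSiteAt S hk (Nat.zero_le k)) G0) (toK S (eSiteAt S hk (Nat.zero_le k)) Gj)
        (toF S (eSiteAt S hk (Nat.zero_le k)) g) (toF S (eSiteAt S hk (Nat.zero_le k)) g') (toS S (eSiteAt S hk (Nat.zero_le k)) φ)
        (toS S (eSiteAt S hk (Nat.zero_le k)) φ') = expr321bT η C.q G0 Gj g g' φ φ' :=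
  ⟨expr321a_bridge S _ (eSiteAt_symm_shift' S hk) η C G g φ φ', expr321b_bridge S _ (eSiteAt_symm_shift' S hk) η C G0 Gj g g' φ φ'⟩

/-- **(3.26) IDENTIFIED**: r15's `lhs326` along `eSiteAt` IS FILE 6's `lhs326T`. [cite: Balaban1983Higgs3, (3.26) p.440] -/
theorem lhs326_eSiteAt (η τ : ℝ) (Gj Gj' Gj'' : HiggsLattice.Site P 0 → HiggsLattice.Site P 0 → ℝ) (g g' : HiggsLattice.Site P 0 → ℝ)
    (A A' : HiggsLattice.VecField P 0) :
    lhs326 η τ (toK S (eSiteAt S hk (Nat.zero_le k)) Gj) (toK S (eSiteAt S hk (Nat.zero_le k)) Gj') (toK S (eSiteAt S hk (Nat.zero_le k)) Gj'')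
        (toF S (eSiteAt S hk (Nat.zero_le k)) g) (toF S (eSiteAt S hk (Nat.zero_le k)) g') (toV S (eSiteAt S hk (Nat.zero_le k)) A)
        (toV S (eSiteAt S hk (Nat.zero_le k)) A') =
      lhs326T η τ Gj Gj' Gj'' g g' A A' :=
  lhs326_bridge S _ (eSiteAt_symm_shift' S hk) η τ Gj Gj' Gj'' g g' A A'

end AtShape

end

end Literature.MathematicalPhysics.QuantumFieldTheory.Balaban1983to89.B3EvaluatorCarrierBridge
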